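import Literature.Topology.FourManifolds.SurfaceGroupCoveringDegree
import HarnessLib

/-!
# Finite-index subgroups of surface groups, IV: the intersection form restricts with degree `± n`

Topic `Literature/Topology/FourManifolds`; theorems only; the Heisenberg-form consequence of the degree
theorem of `SurfaceGroupCoveringDegree.lean`.  For weights `ξ, η : surfaceGen g → ℤ` the tree's form
`omega ξ η : F → ℤ` (`QuadraticWordsForm.lean`: the central coordinate of the Heisenberg evaluation;
on the relator it is the symplectic pairing `∑ᵢ (ξ(aᵢ)η(bᵢ) - ξ(bᵢ)η(aᵢ))`, `omega_surfaceWordStd`) is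
additive and conjugation invariant on the relation subgroup `R = ker proj_g` and kills `[F, R]`
(`omega_eq_zero_of_mem_commutator_ker`; the case `ξ = ξ₀, η = η₀` is Zieschang's `relatorDegree`).
Hence (`exists_sign_omega_lift_surfaceRelator`): for `K ≤ S_g` of index `n`, `e : K ≃* S_h` with the
Riemann–Hurwitz genus `h + n = n g + 1`, and ANY lift `θ : F_h → E = proj⁻¹ K` of `e⁻¹`, there is ONE
sign `ε = ±1` with

  `omega ξ η (θ r_h) = ε · n · omega ξ η (r_g)`   for all `ξ, η`

— the cup-product square `H¹ × H¹ → H²` of a degree-`n` covering of closed oriented surfaces (K. S.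
Brown, *Cohomology of Groups*, III (9.5)(ii), VIII §2), obtained here algebraically (Schreier index
formula + transfer + Hopf, see part III).  The Schreier basis of `E` is supplied by
`FreeGroup.exists_freeGroupBasis_of_finiteIndex` (`SchreierIndexFormula.lean`) by the consumer.
-/

noncomputable section

namespace Literature.Topology.FourManifolds

namespace SurfaceGroup

open Literature.GroupTheory.CombinatorialGroupTheory Subgroup
open scoped commutatorElement

variable {g h : ℕ}

/-! ### The form `omega ξ η` on the relation subgroup -/

/-- Additivity of the form when the first factor lies in `R`. [cite: ZieschangVogtColdewey1980, 5.5.1] -/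
theorem omega_mul_of_mem_ker (ξ η : surfaceGen g → ℤ) {x : FreeGroup (surfaceGen g)}
    (hx : x ∈ (proj g).ker) (y : FreeGroup (surfaceGen g)) :
    omega ξ η (x * y) = omega ξ η x + omega ξ η y := by
  obtain ⟨ha, -⟩ := heisHom_ab_of_mem_ker ξ η hx
  unfold omega
  rw [map_mul, Heis.mul_c, ha, zero_mul, add_zero]

/-- The form of an inverse in `R`. [cite: ZieschangVogtColdewey1980, 5.5.1] -/
theorem omega_inv_of_mem_ker (ξ η : surfaceGen g → ℤ) {x : FreeGroup (surfaceGen g)}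
    (hx : x ∈ (proj g).ker) : omega ξ η x⁻¹ = -omega ξ η x := by
  obtain ⟨ha, -⟩ := heisHom_ab_of_mem_ker ξ η hx
  unfold omega
  rw [map_inv, Heis.inv_c, ha, zero_mul, add_zero]

/-- Conjugation invariance of the form on `R`. [cite: ZieschangVogtColdewey1980, 5.5.1] -/
theorem omega_conj_of_mem_ker (ξ η : surfaceGen g → ℤ) (c : FreeGroup (surfaceGen g))
    {x : FreeGroup (surfaceGen g)} (hx : x ∈ (proj g).ker) :
    omega ξ η (c * x * c⁻¹) = omega ξ η x := by
  obtain ⟨ha, hb⟩ := heisHom_ab_of_mem_ker ξ η hx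
  unfold omega
  rw [map_mul, map_mul, map_inv, Heis.conj_c _ _ ha hb]

/-- The form of a transversal conjugate `u⁻¹ r_g u` is the form of the relator.
[cite: ZieschangVogtColdewey1980, 5.5.1] -/
theorem omega_inv_mul_relator_mul (ξ η : surfaceGen g → ℤ) (u : FreeGroup (surfaceGen g)) :
    omega ξ η (u⁻¹ * surfaceRelator g * u) = omega ξ η (surfaceRelator g) := by
  have h := omega_conj_of_mem_ker ξ η u⁻¹ (surfaceRelator_mem_ker_proj (g := g))
  rwa [inv_inv] at h

/-- The form of `x^k`, `x ∈ R`. [cite: ZieschangVogtColdewey1980, 5.5.1] -/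
theorem omega_zpow_of_mem_ker (ξ η : surfaceGen g → ℤ) {x : FreeGroup (surfaceGen g)}
    (hx : x ∈ (proj g).ker) (k : ℤ) : omega ξ η (x ^ k) = k * omega ξ η x := by
  induction k using Int.induction_on with
  | zero =>
    simp only [zpow_zero, zero_mul]
    unfold omega
    rw [map_one, Heis.one_c]
  | succ n ih =>
    rw [zpow_add_one, omega_mul_of_mem_ker ξ η ((proj g).ker.zpow_mem hx n), ih]; ring
  | pred n ih =>
    rw [zpow_sub_one, omega_mul_of_mem_ker ξ η ((proj g).ker.zpow_mem hx _), ih,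
      omega_inv_of_mem_ker ξ η hx]; ring

/-- The form of a product of elements of `R` is the sum of the forms.
[cite: ZieschangVogtColdewey1980, 5.5.1] -/
theorem omega_list_prod_of_forall_mem_ker (ξ η : surfaceGen g → ℤ) (L : List (FreeGroup (surfaceGen g)))
    (hL : ∀ x ∈ L, x ∈ (proj g).ker) : omega ξ η L.prod = (L.map (omega ξ η)).sum := by
  induction L with
  | nil =>
    simp only [List.prod_nil, List.map_nil, List.sum_nil]
    unfold omega
    rw [map_one, Heis.one_c]
  | cons x L ih =>
    rw [List.prod_cons, omega_mul_of_mem_ker ξ η (hL x (by simp)), List.map_cons, List.sum_cons,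
      ih fun y hy => hL y (by simp [hy])]

/-- The form vanishes on `[F, R]` (and `[F, R] ⊆ R`). [cite: ZieschangVogtColdewey1980, 5.5.1] -/
theorem omega_eq_zero_of_mem_commutator_ker (ξ η : surfaceGen g → ℤ) {x : FreeGroup (surfaceGen g)}
    (hx : x ∈ ⁅(⊤ : Subgroup (FreeGroup (surfaceGen g))), (proj g).ker⁆) :
    x ∈ (proj g).ker ∧ omega ξ η x = 0 := by
  rw [Subgroup.commutator_def] at hx
  induction hx using Subgroup.closure_induction with
  | mem y hy =>
    obtain ⟨a, -, b, hb, rfl⟩ := hy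
    have hab : a * b * a⁻¹ ∈ (proj g).ker := (MonoidHom.normal_ker (proj g)).conj_mem b hb a
    refine ⟨?_, ?_⟩
    · rw [commutatorElement_def]
      exact (proj g).ker.mul_mem hab ((proj g).ker.inv_mem hb)
    · rw [commutatorElement_def, omega_mul_of_mem_ker ξ η hab, omega_conj_of_mem_ker ξ η a hb,
        omega_inv_of_mem_ker ξ η hb, add_neg_cancel]
  | one =>
    refine ⟨one_mem _, ?_⟩
    unfold omega
    rw [map_one, Heis.one_c]
  | mul y z _ _ hy hz =>
    exact ⟨mul_mem hy.1 hz.1, by rw [omega_mul_of_mem_ker ξ η hy.1, hy.2, hz.2, add_zero]⟩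
  | inv y _ hy =>
    exact ⟨inv_mem hy.1, by rw [omega_inv_of_mem_ker ξ η hy.1, hy.2, neg_zero]⟩

/-! ### The form of `θ(r_h)`: degree `± n` -/

/-- **The intersection form restricts with degree `± n`.**  Let `1 ≤ g`, `K ≤ S_g` of finite index
`n`, `e : K ≃* S_h` with `h + n = n g + 1`, `θ : F_h → E = proj⁻¹ K` a lift of `e⁻¹`
(`π_E ∘ θ = e⁻¹ ∘ proj_h`), and suppose `E` has a free basis `ι` with `|ι| + n = n · 2g + 1`
(Schreier).  Then there is ONE sign `ε = ±1` such that for all weights `ξ, η`: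
`omega ξ η (θ r_h) = ε · (n · omega ξ η r_g)`. [cite: Brown1982CohomologyGroups, III (9.5)(ii)] -/
theorem exists_sign_omega_lift_surfaceRelator (hg : 1 ≤ g) (K : Subgroup (SurfaceGroup g))
    [K.FiniteIndex] (e : K ≃* SurfaceGroup h)
    (θ : FreeGroup (surfaceGen h) →* K.comap (proj g))
    (hθ : ∀ x, (proj g).subgroupComap K (θ x) = e.symm (proj h x))
    {ι : Type} [Finite ι] (bE : FreeGroupBasis ι (K.comap (proj g)))
    (hι : Nat.card ι + K.index = K.index * (2 * g) + 1) (hh : h + K.index = K.index * g + 1) :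
    ∃ ε : ℤ, (ε = 1 ∨ ε = -1) ∧ ∀ ξ η : surfaceGen g → ℤ,
      omega ξ η ((θ (surfaceRelator h) : K.comap (proj g)) : FreeGroup (surfaceGen g)) =
        ε * ((K.index : ℤ) * omega ξ η (surfaceRelator g)) := by
  classical
  haveI hEfi : (K.comap (proj g)).FiniteIndex :=
    ⟨by rw [index_comap_proj]; exact FiniteIndex.index_ne_zero⟩
  haveI : Finite (FreeGroup (surfaceGen g) ⧸ K.comap (proj g)) := finite_quotient_of_finiteIndex
  letI : Fintype (FreeGroup (surfaceGen g) ⧸ K.comap (proj g)) := Fintype.ofFinite _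
  -- a lift of `e`, a transversal, the list of cosets
  obtain ⟨θ', hθ'⟩ := exists_lift_from_preimage K e
  let u : FreeGroup (surfaceGen g) ⧸ K.comap (proj g) → FreeGroup (surfaceGen g) := Quotient.out
  have hu : ∀ q, (u q : FreeGroup (surfaceGen g) ⧸ K.comap (proj g)) = q := Quotient.out_eq
  let l := (Finset.univ : Finset (FreeGroup (surfaceGen g) ⧸ K.comap (proj g))).toList
  have hl : ∀ q, q ∈ l := fun q => Finset.mem_toList.mpr (Finset.mem_univ q)
  have hnd : l.Nodup := Finset.nodup_toList _
  have hlen : l.length = K.index := by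
    rw [Finset.length_toList, Finset.card_univ, ← Nat.card_eq_fintype_card, ← index_comap_proj K]; rfl
  obtain ⟨ε, hε, hmem⟩ := coe_lift_surfaceRelator_inv_mul_prod_zpow_mem hg K e θ hθ θ' hθ' u hu l hl
    hnd bE hι hh
  refine ⟨ε, hε, fun ξ η => ?_⟩
  set x := ((θ (surfaceRelator h) : K.comap (proj g)) : FreeGroup (surfaceGen g)) with hx
  set ρ := (l.map fun q => (u q)⁻¹ * surfaceRelator g * u q).prod with hρ
  have hρker : ρ ∈ (proj g).ker := by
    apply Subgroup.list_prod_mem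
    intro y hy
    rw [List.mem_map] at hy
    obtain ⟨q, -, rfl⟩ := hy
    exact conj_relator_mem_ker (u q)
  obtain ⟨-, hc0⟩ := omega_eq_zero_of_mem_commutator_ker ξ η hmem
  -- `x = ρ^ε · c⁻¹` with `c = x⁻¹ ρ^ε ∈ [F, R]`
  have hxeq : x = ρ ^ ε * (x⁻¹ * ρ ^ ε)⁻¹ := by group
  have hcker : (x⁻¹ * ρ ^ ε) ∈ (proj g).ker := (omega_eq_zero_of_mem_commutator_ker ξ η hmem).1
  rw [hxeq, omega_mul_of_mem_ker ξ η ((proj g).ker.zpow_mem hρker ε), omega_inv_of_mem_ker ξ η hcker,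
    hc0, neg_zero, add_zero, omega_zpow_of_mem_ker ξ η hρker, hρ,
    omega_list_prod_of_forall_mem_ker ξ η _ (fun y hy => by
      rw [List.mem_map] at hy
      obtain ⟨q, -, rfl⟩ := hy
      exact conj_relator_mem_ker (u q)), List.map_map]
  have hconst : (l.map ((omega ξ η) ∘ fun q => (u q)⁻¹ * surfaceRelator g * u q)) =
      l.map (fun _ => omega ξ η (surfaceRelator g)) := by
    refine List.map_congr_left fun q _ => ?_
    simp only [Function.comp_apply, omega_inv_mul_relator_mul]
  rw [hconst, List.map_const', List.sum_replicate, hlen, nsmul_eq_mul]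

end SurfaceGroup

end Literature.Topology.FourManifolds
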